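import Literature.AlgebraicGeometry.Frobenioids.Thm49Assembly
import Literature.AlgebraicGeometry.Frobenioids.Thm49CompatOfFunctor
import Literature.AlgebraicGeometry.Frobenioids.ArithmeticFrobenioidFrobeniusCompact
import Literature.AlgebraicGeometry.Frobenioids.ArithmeticFrobenioidIsotropic
import Literature.AlgebraicGeometry.Frobenioids.ArithmeticFrobenioidsProofs
import Literature.AlgebraicGeometry.Frobenioids.BaseSectionsOfObjectsCor57NonVacuity
import HarnessLib

/-!
# Frobenioids I, Theorem 4.9 at the arithmetic Frobenioids `C_{K/F}` of §6 — hypothesis-free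
# (non-vacuity row NV-L1 «[FrdI] Thm. 4.9 closers INHABITED at genuine data»)

Mochizuki, *The geometry of Frobenioids I: the general theory*, Kyushu J. Math. **62** (2008) 293–400,
Theorem 4.9 p. 88 (category-theoreticity of the divisor monoid), applied at the motivating example of
Example 6.3 / Theorem 6.4 (pp. 113–115): the arithmetic Frobenioid `C_{K/F}` of a Galois extension `K/F` of a
number field `F`, over the base category `D = B(Gal(K/F))⁰` of finite subextensions (`FinSubextCat F K`).
[cite: MochizukiFrdI2008, Thm. 4.9 p.88] [cite: MochizukiFrdI2008, Thm. 6.4 (i) p.114]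

PROOF-ONLY file (node FrdI:Thm4.9, genuine-data instance; seat abc-iut-w4-d109, T49-L00 lineage), 0 definitions.
Every hypothesis of the cell's Thm. 4.9 closers `FrdI.T49.thm49_ofFunctor_of_isOfFSMType` (seat abc-iut-w4-d109,
`Thm49Assembly.lean`) and `FrdI.T49.exists_thm49_compat_ofFunctor_of_isOfFSMType` (seat abc-iut-w4-d105,
`Thm49CompatOfFunctor.lean`) is a theorem of the tree at `C_{K/F}`:

* `C_{K/F}` is a Frobenioid (Thm. 5.2 (ii); `arithFrobenioid_isFrobenioid`, seat abc-iut-L6-t10);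
* the base `D = B(Gal(K/F))⁰` is of FSM-type (`FinSubextCat.isOfFSMType`, seat abc-iut-L6-t10);
* `Φ : Spec L ↦ Φ(L)` is perf-factorial objectwise (`EffArithDivisor.isPerfFactorial`, seat abc-iut-L1-d2; packaged
  as `arith_objectwise_isPerfFactorial`, seat abc-iut-L1-d1);
* `C_{K/F}` is of rationally standard type at THE Def. 4.5 (iii) parameters `PreFrobenioid.rsParams` (THE
  birationalization, the primary support of Def. 2.4 (i)(d), THE unit-trivialization and its birationalization;
  Thm. 6.4 (i), `arithFrobenioid_isOfRationallyStandardType_rsParams`, seats abc-iut-w5-d250 / L6-t10) — its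
  "rational" conjunct is literally the closers' hypothesis `hrat₁` ("rational type READ AT THE CONSTRUCTIONS");
* `C_{K/F}` is of standard and isotropic type and NOT of group-like type (Thm. 6.4 (i); `isOfStandardType_arith`,
  `isOfIsotropicType_arith`, `not_isOfGroupLikeType_arith`) — the `Thm42Setting` of the compatibility clause.

Hence, with no hypothesis left: for EVERY equivalence of categories `Ψ : C_{K₁/F₁} ⥲ C_{K₂/F₂}` between
arithmetic Frobenioids
* `FrdI.T49.thm49_arith` — the typed `PreFrobenioidData.Thm49` at THE parameters;
* `FrdI.T49.nonempty_divisorMonoidIsoOver_arith` — its conclusion outright: **there is an isomorphism of functors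
  `Ψ^Φ : Φ₁ ⥲ Φ₂` lying over `Ψ`** (monoid isomorphisms `Φ₁(L) ≃ Φ₂(Base Ψ(Spec L, ·))` natural in the object);
* `FrdI.T49.exists_thm49_compat_arith` — the compatibility clause (typed `Thm49_compat`): a `Ψ^Φ` computing
  `Div(Ψ φ) = Ψ^Φ(Div φ)` on pre-steps and carrying the primes `Φ₁(A)_𝔭` onto `Φ₂(Ψ A)_{Ψ^Prime 𝔭}`.
This is a genuine-data witness that the antecedent package of the cell's Thm. 4.9 closers is inhabited (kind NV
in the cell's bookkeeping; companion of `Cor412Arithmetic.lean`, seat abc-iut-w5-d222, and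
`BaseSectionsOfObjectsCor57NonVacuity.lean`, seat abc-iut-L1-d1). No statement of the paper is restated or
strengthened; nothing here bears on, or takes a side on, [IUTchIII] Cor. 3.12.
-/

noncomputable section

namespace Literature.AlgebraicGeometry.Frobenioids

open CategoryTheory Opposite
open PreFrobenioid PreFrobenioidData

namespace FrdI.T49

section Arith

variable (F₁ : Type) [Field F₁] [NumberField F₁] (K₁ : Type) [Field K₁] [Algebra F₁ K₁] [IsGalois F₁ K₁]
variable (F₂ : Type) [Field F₂] [NumberField F₂] (K₂ : Type) [Field K₂] [Algebra F₂ K₂] [IsGalois F₂ K₂]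

/-! ### The hypotheses of the Thm. 4.9 closers at `C_{K/F}` -/

/-- **"`C_{K/F}` is of rational type" READ AT THE CONSTRUCTIONS** — the hypothesis `hrat₁` of the cell's Thm. 4.9
closers: every object of `C_{K/F}` is rational (Def. 4.5 (ii)) at THE birationalization `C → C^birat` of
Prop. 4.4 and the primary support of Def. 2.4 (i)(d). It is the "rational" conjunct of Thm. 6.4 (i) "`C` is of
rationally standard type" at THE parameters (`arithFrobenioid_isOfRationallyStandardType_rsParams`).
[cite: MochizukiFrdI2008, Thm. 6.4 (i) p.114] -/
theorem arith_isRational_biratData (A : arithFrobenioid F₁ K₁) :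
    PreFrobenioidData.IsRational
      (biratData (arithFrobenioid_isFrobenioid F₁ K₁)
        (hasBiratSquares_of_isFrobenioid (arithFrobenioid_isFrobenioid F₁ K₁)))
      (S := arithFrobenioidOps F₁ K₁) (fun a 𝔭 => PrimarySupp a 𝔭) A :=
  (arithFrobenioid_isOfRationallyStandardType_rsParams F₁ K₁).rational A

/-- The hypotheses of the compatibility clause of Thm. 4.9 (`Thm42Setting`: standard type, isotropic type, not
of group-like type) HOLD for every pair of arithmetic Frobenioids (Thm. 6.4 (i) p. 114: "`C` [is] of isotropic
and rationally standard type, but not of group-like type"). [cite: MochizukiFrdI2008, Thm. 6.4 (i) p.114] -/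
theorem thm42Setting_arith :
    Thm42Setting (arithFrobenioidOps F₁ K₁) (arithFrobenioidOps F₂ K₂) where
  standard := ⟨isOfStandardType_arith F₁ K₁, isOfStandardType_arith F₂ K₂⟩
  isotropic := ⟨isOfIsotropicType_arith F₁ K₁, isOfIsotropicType_arith F₂ K₂⟩
  notGroupLike := ⟨not_isOfGroupLikeType_arith F₁ K₁, not_isOfGroupLikeType_arith F₂ K₂⟩

/-! ### Theorem 4.9 at `C_{K/F}`, hypothesis-free -/

/-- **[FrdI] Thm. 4.9 AS TYPED (`PreFrobenioidData.Thm49`) for a pair of arithmetic Frobenioids `C_{K₁/F₁}`,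
`C_{K₂/F₂}`, any equivalence `Ψ` between them and ANY Def. 4.5 (iii) parameters `R₁, R₂`** — no further input:
the bases `B(Gal(K_i/F_i))⁰` are of FSM-type, the `Φ_i` are perf-factorial, `C_{K₁/F₁}` is of rational type at
THE constructions. [cite: MochizukiFrdI2008, Thm. 4.9 p.88] -/
theorem thm49_arith_rsParams (Ψ : arithFrobenioid F₁ K₁ ≌ arithFrobenioid F₂ K₂)
    (R₁ : (arithFrobenioidOps F₁ K₁).RSParams) (R₂ : (arithFrobenioidOps F₂ K₂).RSParams) :
    (arithFrobenioidOps F₁ K₁).Thm49 (arithFrobenioidOps F₂ K₂) Ψ R₁ R₂ :=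
  thm49_ofFunctor_of_isOfFSMType (arithFrobenioid_isFrobenioid F₁ K₁) (arithFrobenioid_isFrobenioid F₂ K₂)
    (FinSubextCat.isOfFSMType F₁ K₁) (FinSubextCat.isOfFSMType F₂ K₂)
    (arith_objectwise_isPerfFactorial F₁ K₁) (arith_objectwise_isPerfFactorial F₂ K₂)
    (arith_isRational_biratData F₁ K₁) Ψ R₁ R₂

/-- **[FrdI] Thm. 4.9 AS TYPED at THE Def. 4.5 (iii) parameters** of the two arithmetic Frobenioids (support =
the primary support `PrimarySupp` of Def. 2.4 (i)(d)). [cite: MochizukiFrdI2008, Thm. 4.9 p.88] -/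
theorem thm49_arith (Ψ : arithFrobenioid F₁ K₁ ≌ arithFrobenioid F₂ K₂) :
    (arithFrobenioidOps F₁ K₁).Thm49 (arithFrobenioidOps F₂ K₂) Ψ
      (rsParams (arithFrobenioid_isFrobenioid F₁ K₁) fun a 𝔭 => PrimarySupp a 𝔭)
      (rsParams (arithFrobenioid_isFrobenioid F₂ K₂) fun a 𝔭 => PrimarySupp a 𝔭) :=
  thm49_arith_rsParams F₁ K₁ F₂ K₂ Ψ _ _

/-- **The conclusion of [FrdI] Thm. 4.9 at the arithmetic Frobenioids, hypothesis-free**: for EVERY equivalence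
of categories `Ψ : C_{K₁/F₁} ⥲ C_{K₂/F₂}` there is an isomorphism of functors `Ψ^Φ : Φ₁ ⥲ Φ₂` lying over `Ψ`
— monoid isomorphisms `Φ₁(Base A) ≃* Φ₂(Base Ψ(A))` natural in `A` with respect to pull-backs (the antecedents
"`C_i` of rationally standard type" being Thm. 6.4 (i) at THE parameters). [cite: MochizukiFrdI2008, Thm. 4.9 p.88] -/
theorem nonempty_divisorMonoidIsoOver_arith (Ψ : arithFrobenioid F₁ K₁ ≌ arithFrobenioid F₂ K₂) :
    Nonempty (DivisorMonoidIsoOver (arithFrobenioidOps F₁ K₁) (arithFrobenioidOps F₂ K₂) Ψ) :=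
  thm49_arith F₁ K₁ F₂ K₂ Ψ (arithFrobenioid_isOfRationallyStandardType_rsParams F₁ K₁)
    (arithFrobenioid_isOfRationallyStandardType_rsParams F₂ K₂)

/-- The same at a single arithmetic Frobenioid and a self-equivalence `Ψ : C_{K/F} ⥲ C_{K/F}` (e.g. the
identity; the R111-style `refl` instance of the NV register). [cite: MochizukiFrdI2008, Thm. 4.9 p.88] -/
theorem nonempty_divisorMonoidIsoOver_arith_refl :
    Nonempty (DivisorMonoidIsoOver (arithFrobenioidOps F₁ K₁) (arithFrobenioidOps F₁ K₁)
      (CategoryTheory.Equivalence.refl (C := arithFrobenioid F₁ K₁))) :=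
  nonempty_divisorMonoidIsoOver_arith F₁ K₁ F₁ K₁ _

/-! ### The compatibility clause of Theorem 4.9 at `C_{K/F}`, hypothesis-free -/

/-- **[FrdI] Thm. 4.9 with its compatibility clause at the arithmetic Frobenioids, hypothesis-free**: for every
equivalence `Ψ : C_{K₁/F₁} ⥲ C_{K₂/F₂}` there are an isomorphism of functors `Ψ^Φ : Φ₁ ⥲ Φ₂` lying over `Ψ`
which computes `Div(Ψ φ) = Ψ^Φ_A(Div φ)` on pre-steps `φ`, and a family of bijections of primes
`e_A : Prime(Φ₁(A)) ≃ Prime(Φ₂(Ψ A))` (THE `Ψ^Prime` of Thm. 4.2 (ii), characterised by clauses (a), (b) on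
co-angular pre-steps), such that `Ψ^Φ_A` maps `Φ₁(A)_𝔭` onto `Φ₂(Ψ A)_{e_A 𝔭}` — the typed `Thm49_compat` (the
`C_{K_i/F_i}` being of isotropic, standard, non-group-like type, Thm. 6.4 (i)). [cite: MochizukiFrdI2008, Thm. 4.9 p.89] -/
theorem exists_thm49_compat_arith (Ψ : arithFrobenioid F₁ K₁ ≌ arithFrobenioid F₂ K₂) :
    ∃ (E : DivisorMonoidIsoOver (arithFrobenioidOps F₁ K₁) (arithFrobenioidOps F₂ K₂) Ψ)
      (e : ∀ A : arithFrobenioid F₁ K₁,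
        Primes ((arithFrobenioidOps F₁ K₁).Mon ((arithFrobenioidOps F₁ K₁).base.obj A)) ≃
          Primes ((arithFrobenioidOps F₂ K₂).Mon ((arithFrobenioidOps F₂ K₂).base.obj (Ψ.functor.obj A)))),
      (∀ (A : arithFrobenioid F₁ K₁)
          (𝔭 : Primes ((arithFrobenioidOps F₁ K₁).Mon ((arithFrobenioidOps F₁ K₁).base.obj A))),
        (∀ ⦃B : arithFrobenioid F₁ K₁⦄ (φ : A ⟶ B), (arithFrobenioidOps F₁ K₁).IsCoAngularPreStep φ →
            ((arithFrobenioidOps F₁ K₁).div φ ∈ 𝔭.submonoid ↔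
              (arithFrobenioidOps F₂ K₂).div (Ψ.functor.map φ) ∈ (e A 𝔭).submonoid)) ∧
        ∀ ⦃B : arithFrobenioid F₁ K₁⦄ (ψ : B ⟶ A), (arithFrobenioidOps F₁ K₁).IsCoAngularPreStep ψ →
          ((∃ y ∈ 𝔭.submonoid,
              (arithFrobenioidOps F₁ K₁).pull ((arithFrobenioidOps F₁ K₁).base.map ψ) y =
                (arithFrobenioidOps F₁ K₁).div ψ) ↔
            ∃ y ∈ (e A 𝔭).submonoid,
              (arithFrobenioidOps F₂ K₂).pull ((arithFrobenioidOps F₂ K₂).base.map (Ψ.functor.map ψ)) y =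
                (arithFrobenioidOps F₂ K₂).div (Ψ.functor.map ψ))) ∧
      (∀ ⦃A B : arithFrobenioid F₁ K₁⦄ (φ : A ⟶ B),
          IsPreStep (ModelFrobenioid.toElem (arithDivisorFunctor F₁ K₁) (unitsFunctor F₁ K₁) (divNatTrans F₁ K₁)) φ →
          E.iso A (Div (ModelFrobenioid.toElem (arithDivisorFunctor F₁ K₁) (unitsFunctor F₁ K₁) (divNatTrans F₁ K₁)) φ) =
            Div (ModelFrobenioid.toElem (arithDivisorFunctor F₂ K₂) (unitsFunctor F₂ K₂) (divNatTrans F₂ K₂))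
              (Ψ.functor.map φ)) ∧
      (arithFrobenioidOps F₁ K₁).Thm49_compat (arithFrobenioidOps F₂ K₂) Ψ E e :=
  exists_thm49_compat_ofFunctor_of_isOfFSMType' (arithFrobenioid_isFrobenioid F₁ K₁)
    (arithFrobenioid_isFrobenioid F₂ K₂) (FinSubextCat.isOfFSMType F₁ K₁) (FinSubextCat.isOfFSMType F₂ K₂)
    (arith_objectwise_isPerfFactorial F₁ K₁) (arith_objectwise_isPerfFactorial F₂ K₂)
    (arith_isRational_biratData F₁ K₁) Ψ (thm42Setting_arith F₁ K₁ F₂ K₂)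

/-- **The typed compatibility clause `Thm49_compat` is inhabited at the arithmetic Frobenioids** (short form of
`exists_thm49_compat_arith`): some `Ψ^Φ` over `Ψ` and some family of prime bijections satisfy it, for every
`Ψ : C_{K₁/F₁} ⥲ C_{K₂/F₂}`. [cite: MochizukiFrdI2008, Thm. 4.9 p.89] -/
theorem exists_thm49_compat_arith' (Ψ : arithFrobenioid F₁ K₁ ≌ arithFrobenioid F₂ K₂) :
    ∃ (E : DivisorMonoidIsoOver (arithFrobenioidOps F₁ K₁) (arithFrobenioidOps F₂ K₂) Ψ)
      (e : ∀ A : arithFrobenioid F₁ K₁,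
        Primes ((arithFrobenioidOps F₁ K₁).Mon ((arithFrobenioidOps F₁ K₁).base.obj A)) ≃
          Primes ((arithFrobenioidOps F₂ K₂).Mon ((arithFrobenioidOps F₂ K₂).base.obj (Ψ.functor.obj A)))),
      (arithFrobenioidOps F₁ K₁).Thm49_compat (arithFrobenioidOps F₂ K₂) Ψ E e := by
  obtain ⟨E, e, -, -, h⟩ := exists_thm49_compat_arith F₁ K₁ F₂ K₂ Ψ
  exact ⟨E, e, h⟩

end Arith

end FrdI.T49

end Literature.AlgebraicGeometry.Frobenioids

end
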